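import Summits.QuantumFields.GaugeBoot.DiagonalRPTorusInnerHalf
import Summits.QuantumFields.GaugeBoot.DiagonalRPTorusPlaquetteSwap
import HarnessLib

/-!
# The half-action trick for diagonal RP on the torus (gauge-boot, task L3 sequel, 2/7)

HONEST FRAMING (cell `pub-gaugeboot`, page 1 of every file): the venture produces certified bounds
on lattice expectations at stated coupling, gauge group, dimension and torus size; NOT a mass gap,
NOT a continuum limit, NOT a string tension; NOT Yang–Mills-summit-bearing (barriers
`FixedCouplingUltralocality`, `PerturbativeInvisibility`). This module is bookkeeping for a
structural NEGATIVE result (`DiagonalRPTorusInnerHalfNegativeHighDim`: inner-half diagonal RP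
fails on every even torus `(ℤ/L)^d`, `d ≥ 4`, `L ≥ 4`, at small coupling); it discharges nothing
by itself.

## Content (torus `(ℤ/L)^d`, any `d`, mirror `y_i = y_j`, any compact `G`, continuous `ρ`)

Write `δ(y) = y_i - y_j ∈ ℤ/L` (`lay`) and fix a threshold `h` ("the half" = the layers
`δ.val < h`; `h = L/2` is the INNER half of `DiagonalRPTorusInnerHalf`, `h = L/2 + 1` the closed
half of `DiagonalRPTorusNegative`).

* `innerPlaqs i j h` — the plaquettes with all four vertices in the half and not all four on the
  mirror layer `δ = 0`; `swapPlaqs` — their `θ`-images; `restPlaqs` — the rest ("back" plaquettes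
  and mirror plaquettes). For `2h ≤ L + 1` these three sets partition the plaquettes
  (`disjoint_innerPlaqs_swapPlaqs`, `sum_split`; `plaqSwap` and `Re tr ρ((ΘU)_q) = Re tr ρ(U_{θq})`
  are in `DiagonalRPTorusPlaquetteSwap`).
* `halfSum ρ i j h U = Σ_{q ∈ innerPlaqs} Re tr ρ(U_q)` and the **HALF-ACTION TRICK**
  (`wilsonExpectation_trick_eq`): for real observables `A`, with
  `F = A · exp(-β · halfSum)`,
  `⟨(F∘Θ)‾ F⟩_{Λ,β} = Z⁻¹ e^{-βN·#plaquettes} ∫ A(ΘU) A(U) ∏_{q ∈ restPlaqs} e^{β Re tr ρ(U_q)} ∏ dU`: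
  the Boltzmann weights of the half and of its mirror image are CANCELLED by the witness, so that
  only the back/mirror plaquettes weigh the product-Haar integral.
* `F` reads only links with both endpoints in the half whenever `A` does (`halfSum_congr`), so
  `F` is an inner-half (`h = L/2`) / closed-half (`h = L/2 + 1`) observable with `A`
  (`isInnerHalfObservable_trickObs`, `isDiagonalHalfObservable_trickObs`), and the two
  REFUTATION SCHEMAS **`not_innerDiagonalRP_of_trickForm_neg`**,
  **`not_diagonalReflectionPositive_of_trickForm_neg`**: a continuous half observable `A` with a
  NEGATIVE trick form refutes `InnerDiagonalRP` (resp. `DiagonalReflectionPositive`, odd `L`).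

Elementary bookkeeping; no named fact. The trick is the torus-diagonal analogue of the witness
used in `TiltedBoxEvenMidAxisRPNegative` (a factor `e^{+β S_half}` riding on the observable).
-/

open MeasureTheory Complex Finset Function
open scoped ComplexOrder

namespace Summit.QuantumFields.GaugeBoot

open Literature.MathematicalPhysics.QuantumFieldTheory

noncomputable section

namespace DiagRPTube
/-! ## The half, its plaquettes and the half action -/

section Half

variable {d L : ℕ} [NeZero L] {N : ℕ} {G : Type*} [Group G] (ρ : G →* Matrix (Fin N) (Fin N) ℂ)
  (i j : Fin d) (h : ℕ)

/-- `y` lies in the half `δ(y).val < h`. [shape] A parametric definition of a proposition — NOT a fact. [folklore] -/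
def InHalf (y : Site d L) : Prop := (lay i j y).val < h

/-- All four vertices of `q` lie in the half. [shape] A parametric definition of a proposition — NOT a fact. [folklore] -/
def PlaqIn (q : Plaquette d L) : Prop := ∀ a : Fin 4, InHalf i j h (vert q a)

/-- All four vertices of `q` lie on the mirror layer `δ = 0`. [shape] A parametric definition of a proposition — NOT a fact. [folklore] -/
def PlaqMirror (q : Plaquette d L) : Prop := ∀ a : Fin 4, lay i j (vert q a) = 0

/-- `InHalf` is decidable. -/
instance (y : Site d L) : Decidable (InHalf (L := L) i j h y) := by unfold InHalf; infer_instance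
/-- `PlaqIn` is decidable. -/
instance (q : Plaquette d L) : Decidable (PlaqIn (L := L) i j h q) := by unfold PlaqIn; infer_instance
/-- `PlaqMirror` is decidable. -/
instance (q : Plaquette d L) : Decidable (PlaqMirror (L := L) i j q) := by
  unfold PlaqMirror; infer_instance

/-- The INNER PLAQUETTES: all four vertices in the half, not all four on the mirror. -/
def innerPlaqs : Finset (Plaquette d L) :=
  univ.filter fun q => PlaqIn i j h q ∧ ¬ PlaqMirror i j q

/-- Their mirror images. -/
def swapPlaqs : Finset (Plaquette d L) := (innerPlaqs (L := L) i j h).image (plaqSwap i j)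

/-- The REST: plaquettes neither inner nor mirror images of inner ones (the plaquettes touching
the back layers, and the plaquettes inside the mirror layer). -/
def restPlaqs : Finset (Plaquette d L) := univ \ (innerPlaqs i j h ∪ swapPlaqs i j h)

variable {i j h}

/-- Membership in the inner plaquettes. -/
theorem mem_innerPlaqs {q : Plaquette d L} :
    q ∈ innerPlaqs i j h ↔ PlaqIn i j h q ∧ ¬ PlaqMirror i j q := by
  simp [innerPlaqs]

/-- Membership in the mirror images: `q ∈ swapPlaqs ↔ θq ∈ innerPlaqs`. -/
theorem mem_swapPlaqs {q : Plaquette d L} :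
    q ∈ swapPlaqs i j h ↔ plaqSwap i j q ∈ innerPlaqs i j h := by
  unfold swapPlaqs
  rw [mem_image]
  constructor
  · rintro ⟨q', hq', rfl⟩
    rwa [plaqSwap_plaqSwap]
  · intro hq
    exact ⟨plaqSwap i j q, hq, plaqSwap_plaqSwap i j q⟩

/-- Membership in the rest. -/
theorem mem_restPlaqs {q : Plaquette d L} :
    q ∈ restPlaqs i j h ↔ q ∉ innerPlaqs i j h ∧ q ∉ swapPlaqs i j h := by
  simp [restPlaqs, not_or]

/-- `δ` and `-δ` cannot both be small unless `δ = 0` (`2h ≤ L + 1`). -/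
theorem eq_zero_of_val_lt_of_neg_val_lt (hh : 2 * h ≤ L + 1) {δ : ZMod L}
    (h1 : δ.val < h) (h2 : (-δ).val < h) : δ = 0 := by
  by_contra hne
  haveI : NeZero δ := ⟨hne⟩
  rw [ZMod.val_neg_of_ne_zero] at h2
  have := ZMod.val_lt δ
  omega

/-- **The inner plaquettes and their mirror images are disjoint** (`2h ≤ L + 1`, `i ≠ j`). -/
theorem disjoint_innerPlaqs_swapPlaqs (hh : 2 * h ≤ L + 1) :
    Disjoint (innerPlaqs (L := L) i j h) (swapPlaqs i j h) := by
  rw [Finset.disjoint_left]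
  intro q hq hq'
  rw [mem_swapPlaqs, mem_innerPlaqs] at hq'
  rw [mem_innerPlaqs] at hq
  refine hq.2 fun a => ?_
  -- the vertex `vert q a` is `θ` of a vertex of `θq`
  obtain ⟨b, hb⟩ := exists_vert_plaqSwap i j (plaqSwap i j q) a
  rw [plaqSwap_plaqSwap] at hb
  have h1 : (lay i j (vert q a)).val < h := hq.1 a
  have h2 : (lay i j (vert (plaqSwap i j q) b)).val < h := hq'.1 b
  have h3 : lay i j (vert q a) = -lay i j (vert (plaqSwap i j q) b) := by
    rw [hb, lay_siteDiagSwap]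
  have h4 : (-lay i j (vert (plaqSwap i j q) b)).val < h := by rw [← h3]; exact h1
  have := eq_zero_of_val_lt_of_neg_val_lt hh h2 h4
  rw [h3, this, neg_zero]

/-- **The partition** `Σ_all = Σ_inner + Σ_swap + Σ_rest` of any plaquette function. -/
theorem sum_split (hh : 2 * h ≤ L + 1) (f : Plaquette d L → ℝ) :
    ∑ q, f q = ∑ q ∈ innerPlaqs i j h, f q + ∑ q ∈ swapPlaqs i j h, f q +
      ∑ q ∈ restPlaqs i j h, f q := by
  rw [← sum_union (disjoint_innerPlaqs_swapPlaqs hh), restPlaqs,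
    ← sum_union disjoint_sdiff, union_sdiff_of_subset (subset_univ _)]

/-- The sum over the mirror images is the sum of the swapped function over the inner ones. -/
theorem sum_swapPlaqs (f : Plaquette d L → ℝ) :
    ∑ q ∈ swapPlaqs i j h, f q = ∑ q ∈ innerPlaqs i j h, f (plaqSwap i j q) := by
  unfold swapPlaqs
  exact sum_image fun q _ q' _ hqq' => by
    simpa only [plaqSwap_plaqSwap] using congrArg (plaqSwap i j) hqq'

variable (i j h)

/-- The HALF ACTION (without its constant): `Σ_{q inner} Re tr ρ(U_q)`. -/
def halfSum (U : GaugeConfig d L G) : ℝ := ∑ q ∈ innerPlaqs i j h, WilsonRP.plaqRe ρ U q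

/-- The REST WEIGHT `∏_{q ∈ restPlaqs} e^{β Re tr ρ(U_q)}`. -/
def restWeight (β : ℝ) (U : GaugeConfig d L G) : ℝ :=
  ∏ q ∈ restPlaqs i j h, Real.exp (β * WilsonRP.plaqRe ρ U q)

variable {ρ i j h}

/-- The half action of `ΘU` is the sum over the mirror images. -/
theorem halfSum_configDiagSwap [TopologicalSpace G] [IsTopologicalGroup G] [CompactSpace G]
    (hρ : Continuous ρ) (U : GaugeConfig d L G) :
    halfSum ρ i j h (configDiagSwap i j U) = ∑ q ∈ swapPlaqs i j h, WilsonRP.plaqRe ρ U q := by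
  unfold halfSum
  rw [sum_swapPlaqs]
  exact sum_congr rfl fun q _ => plaqRe_configDiagSwap ρ hρ i j U q

/-- **The cancellation**: `e^{-β S(U)} e^{-β halfSum(ΘU)} e^{-β halfSum(U)} =
e^{-βN·#plaquettes} · restWeight β U` (`2h ≤ L + 1`, `i ≠ j`). -/
theorem exp_action_mul_exp_halfSum [TopologicalSpace G] [IsTopologicalGroup G]
    [CompactSpace G] (hρ : Continuous ρ) (hh : 2 * h ≤ L + 1) (β : ℝ)
    (U : GaugeConfig d L G) :
    Real.exp (-β * wilsonAction ρ U) * (Real.exp (-β * halfSum ρ i j h (configDiagSwap i j U)) *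
      Real.exp (-β * halfSum ρ i j h U)) =
      Real.exp (-(β * (N * Fintype.card (Plaquette d L)))) * restWeight ρ i j h β U := by
  unfold restWeight
  rw [WilsonRP.wilsonAction_eq, sum_split hh, halfSum_configDiagSwap hρ, halfSum,
    ← Real.exp_sum, ← Real.exp_add, ← Real.exp_add, ← Real.exp_add, ← mul_sum]
  congr 1
  ring

/-- The half action reads only links both of whose endpoints lie in the half. -/
theorem halfSum_congr {U V : GaugeConfig d L G}
    (hUV : ∀ e : Edge d L, InHalf i j h e.1 → InHalf i j h (e.1.shift e.2) → U e = V e) :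
    halfSum ρ i j h U = halfSum ρ i j h V := by
  unfold halfSum
  refine sum_congr rfl fun q hq => plaqRe_congr ρ q fun a => hUV _ ?_ ?_
  · obtain ⟨b, hb⟩ := link_fst_mem_vert q a
    rw [hb]; exact (mem_innerPlaqs.1 hq).1 b
  · obtain ⟨b, hb⟩ := link_shift_mem_vert q a
    rw [hb]; exact (mem_innerPlaqs.1 hq).1 b

/-- `|halfSum| ≤ N · #plaquettes`. -/
theorem abs_halfSum_le [TopologicalSpace G] [IsTopologicalGroup G] [CompactSpace G]
    (hρ : Continuous ρ) (U : GaugeConfig d L G) :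
    |halfSum ρ i j h U| ≤ N * Fintype.card (Plaquette d L) := by
  unfold halfSum
  calc |∑ q ∈ innerPlaqs i j h, WilsonRP.plaqRe ρ U q|
      ≤ ∑ q ∈ innerPlaqs i j h, |WilsonRP.plaqRe ρ U q| := abs_sum_le_sum_abs _ _
    _ ≤ ∑ _q ∈ innerPlaqs i j h, (N : ℝ) := sum_le_sum fun q _ => WilsonRP.abs_plaqRe_le ρ hρ U q
    _ ≤ ∑ _q : Plaquette d L, (N : ℝ) :=
        sum_le_sum_of_subset_of_nonneg (subset_univ _) fun _ _ _ => Nat.cast_nonneg _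
    _ = N * Fintype.card (Plaquette d L) := by rw [sum_const, card_univ, nsmul_eq_mul, mul_comm]

/-- The half action is continuous. -/
theorem continuous_halfSum [TopologicalSpace G] [ContinuousMul G] [ContinuousInv G]
    (hρ : Continuous ρ) : Continuous (halfSum (d := d) (L := L) (G := G) ρ i j h) := by
  unfold halfSum
  exact continuous_finsetSum _ fun q _ => continuous_plaqRe ρ hρ q

/-- The rest weight is continuous. -/
theorem continuous_restWeight [TopologicalSpace G] [ContinuousMul G] [ContinuousInv G]
    (hρ : Continuous ρ) (β : ℝ) : Continuous (restWeight (d := d) (L := L) (G := G) ρ i j h β) := by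
  unfold restWeight
  exact continuous_finsetProd _ fun q _ =>
    Real.continuous_exp.comp (continuous_const.mul (continuous_plaqRe ρ hρ q))

end Half

/-! ## The trick -/

section Trick

variable {d L N : ℕ} [NeZero L] {G : Type*} [Group G] [TopologicalSpace G] [IsTopologicalGroup G]
  [CompactSpace G] [MeasurableSpace G] [BorelSpace G]
  (ρ : G →* Matrix (Fin N) (Fin N) ℂ) (i j : Fin d) (h : ℕ)

/-- The WITNESS built on a real observable `A`: `F = A · e^{-β halfSum}` (as a complex
observable). -/
def trickObs (β : ℝ) (A : GaugeConfig d L G → ℝ) (U : GaugeConfig d L G) : ℂ :=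
  ((A U * Real.exp (-β * halfSum ρ i j h U) : ℝ) : ℂ)

/-- The TRICK FORM `∫ A(ΘU) A(U) ∏_{q ∈ rest} e^{β Re tr ρ(U_q)} ∏ dU`. -/
def trickForm (β : ℝ) (A : GaugeConfig d L G → ℝ) : ℝ :=
  ∫ U, A (configDiagSwap i j U) * A U * restWeight ρ i j h β U
    ∂Measure.pi fun _ : Edge d L => haarProbability G

variable {i j h}

omit [TopologicalSpace G] [IsTopologicalGroup G] [CompactSpace G] [MeasurableSpace G] [BorelSpace G] in
/-- The witness reads only links with both endpoints in the half whenever `A` does. -/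
theorem trickObs_congr (β : ℝ) {A : GaugeConfig d L G → ℝ} {U V : GaugeConfig d L G}
    (hA : A U = A V)
    (hUV : ∀ e : Edge d L, InHalf i j h e.1 → InHalf i j h (e.1.shift e.2) → U e = V e) :
    trickObs ρ i j h β A U = trickObs ρ i j h β A V := by
  unfold trickObs
  rw [hA, halfSum_congr hUV]

omit [MeasurableSpace G] [BorelSpace G] in
/-- The witness is bounded: `‖F‖ ≤ C e^{|β| N #plaquettes}` if `|A| ≤ C`. -/
theorem norm_trickObs_le (hρ : Continuous ρ) (β : ℝ) {A : GaugeConfig d L G → ℝ} {C : ℝ}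
    (hA : ∀ U, |A U| ≤ C) (U : GaugeConfig d L G) :
    ‖trickObs ρ i j h β A U‖ ≤ C * Real.exp (|β| * (N * Fintype.card (Plaquette d L))) := by
  unfold trickObs
  rw [Complex.norm_real, Real.norm_eq_abs, abs_mul, Real.abs_exp]
  have hC : 0 ≤ C := (abs_nonneg _).trans (hA U)
  refine mul_le_mul (hA U) (Real.exp_le_exp.2 ?_) (Real.exp_nonneg _) hC
  have h1 := abs_halfSum_le (ρ := ρ) (i := i) (j := j) (h := h) hρ U
  have h2 : -β * halfSum ρ i j h U ≤ |β| * |halfSum ρ i j h U| := by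
    rw [← abs_neg β, ← abs_mul]; exact le_abs_self _
  exact h2.trans (mul_le_mul_of_nonneg_left h1 (abs_nonneg _))

omit [CompactSpace G] in
/-- The witness is measurable for continuous `A` (second countable `G`). -/
theorem measurable_trickObs [SecondCountableTopology G] (hρ : Continuous ρ) (β : ℝ)
    {A : GaugeConfig d L G → ℝ} (hA : Continuous A) : Measurable (trickObs ρ i j h β A) := by
  unfold trickObs
  exact Complex.measurable_ofReal.comp (hA.mul (Real.continuous_exp.comp
    (continuous_const.mul (continuous_halfSum (ρ := ρ) hρ)))).measurable

/-- ★ **THE HALF-ACTION TRICK.** For a real continuous observable `A`, `i ≠ j`, `2h ≤ L + 1` and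
`F = A · e^{-β halfSum}`:
`⟨(F∘Θ)‾ F⟩_{Λ,β} = Z⁻¹ · e^{-βN·#plaquettes} · ∫ A(ΘU) A(U) ∏_{q ∈ rest} e^{β Re tr ρ(U_q)} ∏ dU`. -/
theorem wilsonExpectation_trick_eq (hρ : Continuous ρ) (hh : 2 * h ≤ L + 1) (β : ℝ)
    (A : GaugeConfig d L G → ℝ) :
    wilsonExpectation ρ β (fun U : GaugeConfig d L G =>
        (starRingEnd ℂ) (trickObs ρ i j h β A (configDiagSwap i j U)) * trickObs ρ i j h β A U) =
      ((((partitionFunction (d := d) (L := L) ρ β)⁻¹).toReal *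
        (Real.exp (-(β * (N * Fintype.card (Plaquette d L)))) * trickForm ρ i j h β A) : ℝ) : ℂ) := by
  have hint : (fun U : GaugeConfig d L G =>
        (starRingEnd ℂ) (trickObs ρ i j h β A (configDiagSwap i j U)) * trickObs ρ i j h β A U) =
      fun U => (((A (configDiagSwap i j U) * A U *
        (Real.exp (-β * halfSum ρ i j h (configDiagSwap i j U)) *
          Real.exp (-β * halfSum ρ i j h U)) : ℝ) : ℂ)) := by
    funext U
    unfold trickObs
    rw [Complex.conj_ofReal]
    push_cast
    ring
  rw [hint, wilsonExpectation_ofReal_eq ρ hρ β]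
  congr 1
  congr 1
  unfold trickForm
  rw [← integral_const_mul]
  refine integral_congr_ae (ae_of_all _ fun U => ?_)
  dsimp only
  have hkey := exp_action_mul_exp_halfSum (i := i) (j := j) (h := h) (ρ := ρ) hρ hh β U
  calc Real.exp (-β * wilsonAction ρ U) * (A (configDiagSwap i j U) * A U *
        (Real.exp (-β * halfSum ρ i j h (configDiagSwap i j U)) *
          Real.exp (-β * halfSum ρ i j h U)))
      = A (configDiagSwap i j U) * A U * (Real.exp (-β * wilsonAction ρ U) *
          (Real.exp (-β * halfSum ρ i j h (configDiagSwap i j U)) *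
            Real.exp (-β * halfSum ρ i j h U))) := by ring
    _ = Real.exp (-(β * (N * Fintype.card (Plaquette d L)))) *
          (A (configDiagSwap i j U) * A U * restWeight ρ i j h β U) := by rw [hkey]; ring

/-- **Consequence**: if the trick form of a bounded continuous inner-type observable is NEGATIVE,
the RP expectation of the witness is negative (real). -/
theorem wilsonExpectation_trick_neg (hρ : Continuous ρ) (hh : 2 * h ≤ L + 1) {β : ℝ}
    {A : GaugeConfig d L G → ℝ} (hneg : trickForm ρ i j h β A < 0) :
    ¬ (0 ≤ wilsonExpectation ρ β (fun U : GaugeConfig d L G =>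
        (starRingEnd ℂ) (trickObs ρ i j h β A (configDiagSwap i j U)) * trickObs ρ i j h β A U)) := by
  rw [wilsonExpectation_trick_eq ρ hρ hh β A, Complex.zero_le_real, not_le]
  obtain ⟨hZ0, hZtop⟩ := partitionFunction_ne_zero_ne_top (d := d) (L := L) ρ hρ β
  have hZ : 0 < ((partitionFunction (d := d) (L := L) ρ β)⁻¹).toReal :=
    ENNReal.toReal_pos (ENNReal.inv_ne_zero.2 hZtop) (ENNReal.inv_ne_top.2 hZ0)
  have := mul_pos hZ (mul_pos (Real.exp_pos (-(β * (N * Fintype.card (Plaquette d L)))))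
    (neg_pos.2 hneg))
  linarith

end Trick

/-! ## The two halves of record -/

section Halves

variable {d L N : ℕ} [NeZero L] {G : Type*} [Group G] [TopologicalSpace G] [IsTopologicalGroup G]
  [CompactSpace G] [MeasurableSpace G] [BorelSpace G]
  (ρ : G →* Matrix (Fin N) (Fin N) ℂ) {i j : Fin d}

omit [TopologicalSpace G] [IsTopologicalGroup G] [CompactSpace G] [MeasurableSpace G]
  [BorelSpace G] in
/-- **Inner half** (`h = L/2`): the witness on an inner-half observable `A` is an inner-half
observable. -/
theorem isInnerHalfObservable_trickObs (β : ℝ) {A : GaugeConfig d L G → ℝ}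
    (hA : IsInnerHalfObservable i j A) :
    IsInnerHalfObservable i j (trickObs ρ i j (L / 2) β A) :=
  fun U V hUV => trickObs_congr ρ β (hA U V hUV) fun e h1 h2 => hUV e h1 h2

omit [TopologicalSpace G] [IsTopologicalGroup G] [CompactSpace G] [MeasurableSpace G]
  [BorelSpace G] in
/-- **Closed half** (`h = L/2 + 1`): the witness on a closed-half observable `A` is a closed-half
observable. -/
theorem isDiagonalHalfObservable_trickObs (β : ℝ) {A : GaugeConfig d L G → ℝ}
    (hA : IsDiagonalHalfObservable i j A) :
    IsDiagonalHalfObservable i j (trickObs ρ i j (L / 2 + 1) β A) :=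
  fun U V hUV => trickObs_congr ρ β (hA U V hUV) fun e h1 h2 =>
    hUV e (Nat.lt_succ_iff.1 h1) (Nat.lt_succ_iff.1 h2)

/-- ★ **Inner-half diagonal RP is refuted by a negative trick form** (`L` even, `h = L/2`): if some
continuous inner-half real observable `A` has `trickForm ρ i j (L/2) β A < 0`, then
`¬ InnerDiagonalRP ρ β i j`. -/
theorem not_innerDiagonalRP_of_trickForm_neg [SecondCountableTopology G] (hρ : Continuous ρ)
    {β : ℝ} {A : GaugeConfig d L G → ℝ} (hA : Continuous A)
    (hAI : IsInnerHalfObservable i j A) (hneg : trickForm ρ i j (L / 2) β A < 0) :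
    ¬ InnerDiagonalRP (d := d) (L := L) ρ β i j := by
  intro hRP
  obtain ⟨C, hC⟩ := isCompact_univ.exists_bound_of_continuousOn hA.continuousOn
  have hC' : ∀ U, |A U| ≤ C := fun U => by simpa using hC U (Set.mem_univ _)
  exact wilsonExpectation_trick_neg ρ hρ (by omega) hneg
    (hRP _ (measurable_trickObs ρ hρ β hA) ⟨_, norm_trickObs_le ρ hρ β hC'⟩
      (isInnerHalfObservable_trickObs ρ β hAI))

/-- ★ **Closed-half diagonal RP is refuted by a negative trick form** (`L` odd, `h = L/2 + 1`). -/
theorem not_diagonalReflectionPositive_of_trickForm_neg [SecondCountableTopology G]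
    (hρ : Continuous ρ) (hL : Odd L) {β : ℝ} {A : GaugeConfig d L G → ℝ}
    (hA : Continuous A) (hAI : IsDiagonalHalfObservable i j A)
    (hneg : trickForm ρ i j (L / 2 + 1) β A < 0) :
    ¬ DiagonalReflectionPositive (d := d) (L := L) ρ β i j := by
  intro hRP
  obtain ⟨C, hC⟩ := isCompact_univ.exists_bound_of_continuousOn hA.continuousOn
  have hC' : ∀ U, |A U| ≤ C := fun U => by simpa using hC U (Set.mem_univ _)
  obtain ⟨c, hc⟩ := hL
  exact wilsonExpectation_trick_neg ρ hρ (by omega) hneg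
    (hRP _ (measurable_trickObs ρ hρ β hA) ⟨_, norm_trickObs_le ρ hρ β hC'⟩
      (isDiagonalHalfObservable_trickObs ρ β hAI))

end Halves

end DiagRPTube

end

end Summit.QuantumFields.GaugeBoot
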